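import Summits.AtomisticToContinuum.Crystallization.Theses.FluxTubeKepler
import Summits.AtomisticToContinuum.Crystallization.Theorems.PerronTransitivityTransitiveLocalLimitOfLayeredWindows
import Summits.AtomisticToContinuum.Crystallization.Theorems.FluxTubeKeplerFluxCellKeplerGoodSitesWindows
import Summits.AtomisticToContinuum.Crystallization.Theorems.FluxTubeKeplerFluxCellKeplerNecessity

/-!
# `FluxCellKepler` (stmt-AtomisticToContinuum-15221), line `Sketch` — consequences of the τ-free
# defect pricing: layered windows, the periodic minimiser, and the sub-problem itself

The registered stub `stub_defectPricedExcess` of the line's skeleton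
(`Cruxes/FluxCellKepler/Lines/Sketch.lean`) is the τ-free defect pricing

  `∀ δ > 0, ∀ R η > 0, ∃ c > 0, c · #bad_(R,η)(x) ≤ E_LJ(x) − N · ⨅_Q e(Q)`

on every finite `δ`-separated injective configuration `x` of `ℝ³` (`bad` = sites whose
`R`-neighbourhood of relative positions is not two-way `η`-matched with a member of the relaxed
Barlow / layered family).  This file certifies what it already carries, through PROVED tree
theorems only:

* `eventually_exists_good_of_defectPricing` — along every sequence of Lennard-Jones ground states
  and at every scale `(R, η)`, for all large `N` some site is `(R, η)`-layered-good (uniform minimal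
  distance `LennardJonesMinimalDistance_holds`, `E(N)/N → e*` = `ChargedEnergyGapNegative.crysEnergyLimit`);
* `layeredWindows_of_defectPricing` — hence `HullMinimality.LayeredWindows` (item 11778), by the
  landed compactness stub `FluxCellKeplerSketch.stub_layeredWindowsOfGoodSites`;
* `crysPeriodicMinAttained_of_defectPricing` — hence a periodic Lennard-Jones minimiser exists
  (item 0627; `TransitiveLocalLimitMotifTwo.crysPeriodicMinAttained_of_layeredWindows`): the former
  skeleton stub `stub_periodicMinimiser` is REDUNDANT given `stub_defectPricedExcess`;
* `crystallization_of_defectPricing` — hence the whole sub-problem statement `Crystallization`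
  (`TransitiveLocalLimitMotifTwo.crystallization_of_layeredWindows`);
* `crystallization_of_fluxCellKepler` — and since the crux implies the pricing
  (`FluxCellKeplerSketchNec.stub_cruxNecessity`), `FluxCellKepler → Crystallization` directly: the
  route's deciding chain needs no item but its rank-2 crux.
-/

namespace Summit.AtomisticToContinuum.Crystallization.Theorems.FluxCellKeplerSketch

open scoped BigOperators
open Literature.MathematicalPhysics.StatisticalMechanics

/-- **Good sites along ground states from the τ-free pricing.** If the `(R, η)`-layered-bad sites of
`δ`-separated finite configurations are priced linearly against `E_LJ − N e*` (the registered stub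
`stub_defectPricedExcess`, taken as hypothesis), then along every sequence of Lennard-Jones ground
states, for all large `N`, some site of `x N` is `(R, η)`-layered-good: ground states are uniformly
`δ₀`-separated (`LennardJonesMinimalDistance_holds`), the pricing at `(δ₀, R, η)` gives
`c · #bad ≤ E(N) − N e*`, and `E(N)/N → e*` (`crysEnergyLimit`) makes the right-hand side `< c N`
eventually. [folklore] -/
theorem eventually_exists_good_of_defectPricing
    (h₂ : ∀ δ : ℝ, 0 < δ → ∀ R η : ℝ, 0 < R → 0 < η → ∃ c : ℝ, 0 < c ∧ ∀ (N : ℕ) (x : Fin N → EuclideanSpace ℝ (Fin 3)), Function.Injective x → (∀ i j, i ≠ j → δ ≤ dist (x i) (x j)) → c * (Nat.card {i : Fin N // ¬ ∃ a : ℝ, 47 / 50 ≤ a ∧ a ≤ 1 ∧ ∃ (A : EuclideanSpace ℝ (Fin 3) →ₗᵢ[ℝ] EuclideanSpace ℝ (Fin 3)) (s : ℤ → ℤ) (z : ℤ → ℝ), IsHaggSeq s ∧ (∀ m : ℤ, 39 / 50 * a ≤ z (m + 1) - z m ∧ z (m + 1) - z m ≤ 17 / 20 * a) ∧ let S : Set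 (EuclideanSpace ℝ (Fin 3)) := {p | ∃ m k l : ℤ, p = A (((k : ℝ) • triangularVec₁ a) + ((l : ℝ) • triangularVec₂ a) + ((haggLabel s m : ℝ) • barlowOffset a) + (z m • layerNormal 1))}; (∀ p ∈ S, ‖p‖ ≤ R → ∃ j : Fin N, dist (x j - x i) p ≤ η) ∧ (∀ j : Fin N, ‖x j - x i‖ ≤ R → ∃ p ∈ S, dist (x j - x i) p ≤ η)} : ℝ) ≤ interactionEnergy lennardJones x - (N : ℝ) * ⨅ Q : PeriodicConfiguration 3, Q.energyPerParticle lennardJones)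
    (x : (N : ℕ) → (Fin N → EuclideanSpace ℝ (Fin 3))) (hx : ∀ N, IsGroundState lennardJones (x N))
    (R η : ℝ) (hR : 0 < R) (hη : 0 < η) :
    ∀ᶠ N in Filter.atTop, ∃ i : Fin N, ∃ a : ℝ, 47 / 50 ≤ a ∧ a ≤ 1 ∧ ∃ (A : EuclideanSpace ℝ (Fin 3) →ₗᵢ[ℝ] EuclideanSpace ℝ (Fin 3)) (s : ℤ → ℤ) (z : ℤ → ℝ), IsHaggSeq s ∧ (∀ m : ℤ, 39 / 50 * a ≤ z (m + 1) - z m ∧ z (m + 1) - z m ≤ 17 / 20 * a) ∧ let S : Set (EuclideanSpace ℝ (Fin 3)) := {p | ∃ m k l : ℤ, p = A (((k : ℝ) • triangularVec₁ a) + ((l : ℝ) • triangularVec₂ a) + ((haggLabel s m : ℝ) • barlowOffset a) + (z m • layerNormal 1))}; (∀ p ∈ S, ‖p‖ ≤ R → ∃ j : Fin N, dist (x N j - x N i) p ≤ η) ∧ (∀ j : Fin N, ‖x N j - x N i‖ ≤ R → ∃ p ∈ S, dist (x N j - x N i) p ≤ η) := by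
  obtain ⟨δ₀, hδ₀, hsepGS⟩ := LennardJonesMinimalDistance_holds
  obtain ⟨c, hc, hcb⟩ := h₂ δ₀ hδ₀ R η hR hη
  have hlim :=
    Summit.AtomisticToContinuum.Crystallization.Theorems.ChargedEnergyGapNegative.crysEnergyLimit
  set e : ℝ := ⨅ Q : PeriodicConfiguration 3, Q.energyPerParticle lennardJones with he
  have hev : ∀ᶠ N : ℕ in Filter.atTop, groundStateEnergy lennardJones 3 N / N < e + c :=
    hlim (Iio_mem_nhds (by linarith))
  filter_upwards [hev, Filter.eventually_ge_atTop 1] with N hN hN1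
  by_contra hall
  rw [not_exists] at hall
  have hcard : Nat.card {i : Fin N // ¬ ∃ a : ℝ, 47 / 50 ≤ a ∧ a ≤ 1 ∧ ∃ (A : EuclideanSpace ℝ (Fin 3) →ₗᵢ[ℝ] EuclideanSpace ℝ (Fin 3)) (s : ℤ → ℤ) (z : ℤ → ℝ), IsHaggSeq s ∧ (∀ m : ℤ, 39 / 50 * a ≤ z (m + 1) - z m ∧ z (m + 1) - z m ≤ 17 / 20 * a) ∧ let S : Set (EuclideanSpace ℝ (Fin 3)) := {p | ∃ m k l : ℤ, p = A (((k : ℝ) • triangularVec₁ a) + ((l : ℝ) • triangularVec₂ a) + ((haggLabel s m : ℝ) • barlowOffset a) + (z m • layerNormal 1))}; (∀ p ∈ S, ‖p‖ ≤ R → ∃ j : Fin N, dist (x N j - x N i) p ≤ η) ∧ (∀ j : Fin N, ‖x N j - x N i‖ ≤ R → ∃ p ∈ S, dist (x N j - x N i) p ≤ η)} = N := by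
    rw [Nat.card_congr (Equiv.subtypeUnivEquiv hall), Nat.card_eq_fintype_card, Fintype.card_fin]
  have hkey := hcb N (x N) (hx N).1 (hsepGS N (x N) (hx N))
  rw [hcard, (hx N).2] at hkey
  have hNr : (0 : ℝ) < N := by exact_mod_cast hN1
  rw [div_lt_iff₀ hNr] at hN
  nlinarith

/-- **Layered windows from the τ-free pricing** (`HullMinimality.LayeredWindows`, item
stmt-AtomisticToContinuum-11778): good sites eventually at every scale
(`eventually_exists_good_of_defectPricing`) and the landed compactness-in-the-spacing stub
`stub_layeredWindowsOfGoodSites`. [folklore] -/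
theorem layeredWindows_of_defectPricing
    (h₂ : ∀ δ : ℝ, 0 < δ → ∀ R η : ℝ, 0 < R → 0 < η → ∃ c : ℝ, 0 < c ∧ ∀ (N : ℕ) (x : Fin N → EuclideanSpace ℝ (Fin 3)), Function.Injective x → (∀ i j, i ≠ j → δ ≤ dist (x i) (x j)) → c * (Nat.card {i : Fin N // ¬ ∃ a : ℝ, 47 / 50 ≤ a ∧ a ≤ 1 ∧ ∃ (A : EuclideanSpace ℝ (Fin 3) →ₗᵢ[ℝ] EuclideanSpace ℝ (Fin 3)) (s : ℤ → ℤ) (z : ℤ → ℝ), IsHaggSeq s ∧ (∀ m : ℤ, 39 / 50 * a ≤ z (m + 1) - z m ∧ z (m + 1) - z m ≤ 17 / 20 * a) ∧ let S : Set (EuclideanSpace ℝ (Fin 3)) := {p | ∃ m k l : ℤ, p = A (((k : ℝ) • triangularVec₁ a) + ((l : ℝ) • triangularVec₂ a) + ((haggLabel s m : ℝ) • barlowOffset a) + (z m • layerNormal 1))}; (∀ p ∈ S, ‖p‖ ≤ R → ∃ j : Fin N, dist (x j - x i) p ≤ η) ∧ (∀ j : Fin N, ‖x j - x i‖ ≤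 R → ∃ p ∈ S, dist (x j - x i) p ≤ η)} : ℝ) ≤ interactionEnergy lennardJones x - (N : ℝ) * ⨅ Q : PeriodicConfiguration 3, Q.energyPerParticle lennardJones) :
    Summit.AtomisticToContinuum.Crystallization.Theses.HullMinimality.LayeredWindows := by
  intro x hx
  exact stub_layeredWindowsOfGoodSites x fun R η hR hη =>
    (eventually_exists_good_of_defectPricing h₂ x hx R η hR hη).frequently

/-- **A periodic Lennard-Jones minimiser from the τ-free pricing** (item stmt-AtomisticToContinuum-0627,
`CrysPeriodicMinAttained`, verbatim): `layeredWindows_of_defectPricing` and the landed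
`TransitiveLocalLimitMotifTwo.crysPeriodicMinAttained_of_layeredWindows`.  In particular the
skeleton stub `stub_periodicMinimiser` of line `Sketch` (v1) follows from `stub_defectPricedExcess`.
[folklore] -/
theorem crysPeriodicMinAttained_of_defectPricing
    (h₂ : ∀ δ : ℝ, 0 < δ → ∀ R η : ℝ, 0 < R → 0 < η → ∃ c : ℝ, 0 < c ∧ ∀ (N : ℕ) (x : Fin N → EuclideanSpace ℝ (Fin 3)), Function.Injective x → (∀ i j, i ≠ j → δ ≤ dist (x i) (x j)) → c * (Nat.card {i : Fin N // ¬ ∃ a : ℝ, 47 / 50 ≤ a ∧ a ≤ 1 ∧ ∃ (A : EuclideanSpace ℝ (Fin 3) →ₗᵢ[ℝ] EuclideanSpace ℝ (Fin 3)) (s : ℤ → ℤ) (z : ℤ → ℝ), IsHaggSeq s ∧ (∀ m : ℤ, 39 / 50 * a ≤ z (m + 1) - z m ∧ z (m + 1) - z m ≤ 17 / 20 * a) ∧ let S : Set (EuclideanSpace ℝ (Fin 3)) := {p | ∃ m k l : ℤ, p = A (((k : ℝ) • triangularVec₁ a) + ((l : ℝ) • triangularVec₂ a) + ((haggLabel s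 m : ℝ) • barlowOffset a) + (z m • layerNormal 1))}; (∀ p ∈ S, ‖p‖ ≤ R → ∃ j : Fin N, dist (x j - x i) p ≤ η) ∧ (∀ j : Fin N, ‖x j - x i‖ ≤ R → ∃ p ∈ S, dist (x j - x i) p ≤ η)} : ℝ) ≤ interactionEnergy lennardJones x - (N : ℝ) * ⨅ Q : PeriodicConfiguration 3, Q.energyPerParticle lennardJones) :
    ∃ P : PeriodicConfiguration 3,
      IsLeast (Set.range fun Q : PeriodicConfiguration 3 => Q.energyPerParticle lennardJones)
        (P.energyPerParticle lennardJones) :=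
  Summit.AtomisticToContinuum.Crystallization.Theorems.TransitiveLocalLimitMotifTwo.crysPeriodicMinAttained_of_layeredWindows
    (layeredWindows_of_defectPricing h₂)

/-- **The sub-problem from the τ-free pricing**: `stub_defectPricedExcess → Crystallization`
(`layeredWindows_of_defectPricing` and the landed
`TransitiveLocalLimitMotifTwo.crystallization_of_layeredWindows`). [folklore] -/
theorem crystallization_of_defectPricing
    (h₂ : ∀ δ : ℝ, 0 < δ → ∀ R η : ℝ, 0 < R → 0 < η → ∃ c : ℝ, 0 < c ∧ ∀ (N : ℕ) (x : Fin N → EuclideanSpace ℝ (Fin 3)), Function.Injective x → (∀ i j, i ≠ j → δ ≤ dist (x i) (x j)) → c * (Nat.card {i : Fin N // ¬ ∃ a : ℝ, 47 / 50 ≤ a ∧ a ≤ 1 ∧ ∃ (A : EuclideanSpace ℝ (Fin 3) →ₗᵢ[ℝ] EuclideanSpace ℝ (Fin 3)) (s : ℤ → ℤ) (z : ℤ → ℝ), IsHaggSeq s ∧ (∀ m : ℤ, 39 / 50 * a ≤ z (m + 1) - z m ∧ z (m + 1) - z m ≤ 17 / 20 * a) ∧ let S : Set (EuclideanSpace ℝ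 (Fin 3)) := {p | ∃ m k l : ℤ, p = A (((k : ℝ) • triangularVec₁ a) + ((l : ℝ) • triangularVec₂ a) + ((haggLabel s m : ℝ) • barlowOffset a) + (z m • layerNormal 1))}; (∀ p ∈ S, ‖p‖ ≤ R → ∃ j : Fin N, dist (x j - x i) p ≤ η) ∧ (∀ j : Fin N, ‖x j - x i‖ ≤ R → ∃ p ∈ S, dist (x j - x i) p ≤ η)} : ℝ) ≤ interactionEnergy lennardJones x - (N : ℝ) * ⨅ Q : PeriodicConfiguration 3, Q.energyPerParticle lennardJones) :
    _root_.Crystallization :=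
  Summit.AtomisticToContinuum.Crystallization.Theorems.TransitiveLocalLimitMotifTwo.crystallization_of_layeredWindows
    (layeredWindows_of_defectPricing h₂)

/-- **The sub-problem from the crux alone**: `FluxCellKepler → Crystallization`.  The crux implies
the τ-free pricing (`FluxCellKeplerSketchNec.stub_cruxNecessity`, landed), and the pricing implies
the sub-problem (`crystallization_of_defectPricing`).  So the deciding chain of route
`FluxTubeKepler` (`closes : FluxCellKepler → PeriodicGivenLayered → KeplerEnergyFloor →
FloorGivesLayered → Crystallization`) needs none of its hypotheses but the first. [folklore] -/
theorem crystallization_of_fluxCellKepler : Summit.AtomisticToContinuum.Crystallization.Theses.FluxTubeKepler.FluxCellKepler → _root_.Crystallization :=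
  fun hX => crystallization_of_defectPricing
    (Summit.AtomisticToContinuum.Crystallization.Theorems.FluxCellKeplerSketchNec.stub_cruxNecessity hX).2

/-- **Layered windows from the crux alone**: `FluxCellKepler → HullMinimality.LayeredWindows`
(item 11778). [folklore] -/
theorem layeredWindows_of_fluxCellKepler
    (hX : Summit.AtomisticToContinuum.Crystallization.Theses.FluxTubeKepler.FluxCellKepler) :
    Summit.AtomisticToContinuum.Crystallization.Theses.HullMinimality.LayeredWindows :=
  layeredWindows_of_defectPricing
    (Summit.AtomisticToContinuum.Crystallization.Theorems.FluxCellKeplerSketchNec.stub_cruxNecessity hX).2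

end Summit.AtomisticToContinuum.Crystallization.Theorems.FluxCellKeplerSketch
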